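import Mathlib
import Literature.NumberTheory.Automorphic.BaseChangeStrongCuspidalPrime
import Literature.NumberTheory.Automorphic.UnitaryCoherentGaloisRep
import Literature.NumberTheory.Automorphic.HarrisLanTaylorThorneCor627
import Literature.NumberTheory.Automorphic.ReciprocityGLnProofs
import HarnessLib

/-!
# HarrisLanTaylorThorneTwistedPairLimit

Topic `Literature/NumberTheory/Automorphic`. Named literature fact(s) relocated by the gate from `Summits/Langlands/Langlands/Theorems/IrreducibilityBySelfDualityGaloisRepGL2CMaeOfFacts.lean`
(accept-time relocation of `[cite]`d propositions written inline in a Summits proposal; human ruling 2026-08-15).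
Sources: FakhruddinPilloni2021, HarrisLanTaylorThorneRMS2016.

* `Literature.NumberTheory.Automorphic.HarrisLanTaylorThorne2016_corollary13_cuspidalUnitary`
* `Literature.NumberTheory.Automorphic.HarrisLanTaylorThorne2016_twistedPairLimit_two` — **REFUTED AS
  STATED, deprecated** (verdict clean-up 2026-08-17, see the section below): the prescription at the
  good places is the Frobenius polynomial of Cor. 6.27's `R_{p,ı}(π, N)`, whereas §6 makes a limit of
  classical cusp forms out of the eigensystem of `ı⁻¹ Ind(π^∞‖det‖^N)`, whose Galois avatar is
  `R_{p,ı}(π, N) ⊗ ε_p^{N}` (proof of Cor. 6.27, p. 225: "Take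
  `R_{p,ı}(π, N) = R_p(ı⁻¹(π^∞‖det‖^N)) ⊗ ε_p^{-N}`"); as typed the fact contradicts the
  conjugate-self-duality of base change from `U(4)`.
* `Literature.NumberTheory.Automorphic.HarrisLanTaylorThorne2016_inducedPairLimit_two` — the
  CORRECTED statement (review-split restatement, 2026-08-17, source re-read: Res. Math. Sci. 3:37,
  pp. 11, 197–200, 224–225): prescription at the good places
  `arithFrobPolyOfSatake ι q_v 2 (α_v q_v^{-N}) · ∏_{b ∈ B_v} (X - b q_v^{-N})` — the arithmetic-Frobenius
  polynomial of `R_p(ı⁻¹(π^∞‖det‖^N)) = r ε_p^{N} ⊕ r^{c,∨} ε_p^{-3-N}` (Cor. 6.26 applied to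
  `π‖det‖^N`) — every other clause verbatim.  It is literally the route stub S1'
  `stub_inducedPairLimit` of `Summits/Langlands/Langlands/Cruxes/GaloisRepGL2CMae/Lines/Sketch.lean`.

## Verdict clean-up (2026-08-17): `HarrisLanTaylorThorne2016_twistedPairLimit_two` is RETIRED FROM LITERATURE DEBT as refuted

The proposition is not a literature fact and can never be discharged.  Re-verified against the
source (Res. Math. Sci. 3:37, p. 225, proof of Cor. 6.27, verbatim: "Take
`R_{p,ı}(π, N) = R_p(ı⁻¹(π^∞‖det‖^N)) ⊗ ε_p^{-N}`"; §1.3, pp. 29–30: `BC(Π)_{w_i} = Π_{w_i}`,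
`BC(Π)_{c w_i} = Π_{w_i}^{∨,c}`, "in both cases `BC(Π_v)` does not depend on `ψ`") and against the
tree, where its refutations are kernel-checked theorems (axioms `propext`, `Classical.choice`,
`Quot.sound` only) of the two sibling files, which import this one and therefore cannot be merged
into it:

* `Literature.NumberTheory.Automorphic.HarrisLanTaylorThorne2016_twistedPairLimit_two.elim`
  (`HarrisLanTaylorThorneTwistedPairLimitMisstated.lean`): the fact together with ANY instance of its
  data (a CM presentation `K/Fp`, `p` split in an imaginary quadratic `E₀ ⊆ K`, a regular algebraic
  cuspidal `π` on `GL₂(𝔸_K)`, `ι : ℚ̄_p ≃+* ℂ`) proves `False` — at an inert good place `w` every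
  approximant `Q_i w` has constant coefficient exactly `q_w^{-6}` (`β₃ = β₀⁻¹`, `β₂ = β₁⁻¹`), an
  integer identity the transfer clause passes to the limit, whereas the prescription's is
  `c · q_w^{-4N}`, `c ≠ 0` independent of `N`; hence
  `HarrisLanTaylorThorne2016_twistedPairLimit_two_iff_forall_not_isRegularAlgebraic` (same file): the
  fact, as typed, is EQUIVALENT to the non-existence of regular algebraic cuspidal automorphic
  representations of `GL₂` over CM fields of that shape — none of the content of §6 survives;
* `Literature.NumberTheory.Automorphic.HarrisLanTaylorThorne2016_twistedPairLimit_two.not_of_arthurClozel`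
  (`HarrisLanTaylorThorneTwistedPairLimitVsBaseChange.lean`):
  `ArthurClozel1989_strongLifting_cuspidal → ArthurClozel1989_strongLifting_archimedean → ¬` the fact
  (Ramanujan's `Δ`, the tree's PROVED dictionary `f ↦ π_f` over `ℚ`, `DeligneSerre1974.hdict_holds`,
  and quadratic base change to `ℚ(√-23)`), i.e. `¬` the fact modulo exactly the two Arthur–Clozel
  base-change leaves (Ann. of Math. Stud. 120, Ch. 3, Thm. 4.2 (a) with Thm. 5.1 — established
  theorems, undischarged named facts of the tree) which its own dependents
  `Summit.Langlands.….GaloisRepGL2CMae_of_facts(')` already take as hypotheses next to it, so that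
  hypothesis set is jointly contradictory
  (`HarrisLanTaylorThorne2016_twistedPairLimit_two.false_of_arthurClozel`).  An unconditional `¬` is
  exactly as far away as a regular algebraic cuspidal automorphic representation of `GL₂` over a CM
  field constructed in the tree's own model of automorphic forms (base change / automorphic
  induction / theta lifting — XL, not attempted here).

Following the verdict (tenured prove-seat, `refuted`; re-checked here), the `def` is kept **statement
byte-for-byte** but carries `@[deprecated]` with a pointer to the refuting theorems and to the
corrected statement: it cannot be deleted while its refutations name it (the two siblings above) and
while the Summits records `Summits/Langlands/Langlands/Theorems/IrreducibilityBySelfDualityGaloisRepGL2CMaeOfFacts.lean`,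
`…GaloisRepGL2CMaeConditional.lean` (`GaloisRepGL2CMae_of_facts'`, hypothesis `h₁`) and
`Summits/Langlands/Langlands/Cruxes/GaloisRepGL2CMae/Lines/Sketch.lean` (an `example` feeding it to
`.elim`) name it by full name; every such use now raises a `deprecated` warning naming the
replacement.  No `HarrisLanTaylorThorne2016_twistedPairLimit_two_holds` can exist; nothing may be
built on the proposition except its negation.  The CORRECTED, source-faithful statement is
`HarrisLanTaylorThorne2016_inducedPairLimit_two` below (prescription twisted by `ε_p^{N}`; a named
fact, XL), to which problem-side users migrate (the route stub S1' `stub_inducedPairLimit` is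
literally it).
-/

namespace Literature.NumberTheory.Automorphic

open scoped MatrixGroups Matrix NumberField Polynomial
open NumberField IsDedekindDomain Field Polynomial Filter
open Literature.NumberTheory.Automorphic Literature.NumberTheory.GaloisRepresentations
open Literature.NumberTheory.Automorphic.HarrisLanTaylorThorne2016

/-- **Refuted as stated — deprecated (verdict clean-up 2026-08-17); kept, statement byte-for-byte,
only because its refutations (sibling files `…Misstated.lean`, `…VsBaseChange.lean`) and the Summits
records `GaloisRepGL2CMae_of_facts(')` / the `GaloisRepGL2CMae` sketch name it; retired from
literature debt (no `_holds` can exist — do not try to prove; do not consume).**  Refutation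
(kernel-checked, kept): `HarrisLanTaylorThorne2016_twistedPairLimit_two.not_of_arthurClozel :
ArthurClozel1989_strongLifting_cuspidal → ArthurClozel1989_strongLifting_archimedean → ¬` this fact
(modulo exactly the two Arthur–Clozel base-change leaves), and unconditionally
`HarrisLanTaylorThorne2016_twistedPairLimit_two.elim` (this fact + ANY instance of its data → `False`)
with `HarrisLanTaylorThorne2016_twistedPairLimit_two_iff_forall_not_isRegularAlgebraic` (the fact is
equivalent to the non-existence of its data); corrected statement:
`HarrisLanTaylorThorne2016_inducedPairLimit_two` (this file).  Audit against the source (2026-08-17):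
the prescription below at the good places, `arithFrobPolyOfSatake ι q_v 2 α_v · ∏ (X - b q_v^{-2N})`,
is the Frobenius polynomial of Cor. 6.27's `R_{p,ı}(π, N) = r ⊕ r^{c,∨} ε_p^{1-2n-2N}`, but the
object that §6 exhibits as a limit of classical cusp forms is the eigensystem of
`Π_N = ı⁻¹ Ind(π^∞‖det‖^N)`, with Galois avatar `R_p(Π_N) = R_{p,ı}(π, N) ⊗ ε_p^{N}` (proof of
Cor. 6.27, Res. Math. Sci. p. 225, verbatim: "Take `R_{p,ı}(π, N) = R_p(ı⁻¹(π^∞‖det‖^N)) ⊗ ε_p^{-N}`").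
Base change from `U(4)` is conjugate self-dual (§1.3), so at an inert good place `w` every
approximant has constant Frobenius coefficient exactly `q_w^{-6}`, an integer identity that the
transfer clause passes to the limit, whereas the prescription's is `c · q_w^{-4N}`: the sibling
`HarrisLanTaylorThorneTwistedPairLimitMisstated.lean` PROVES that this fact together with ANY instance
of its data yields `False` (`HarrisLanTaylorThorne2016_twistedPairLimit_two.elim`), and records the
corrected statement (prescription `arithFrobPolyOfSatake ι q_v 2 (α_v q_v^{-N}) · ∏ (X - b q_v^{-N})`,
all other clauses verbatim), filed below as `HarrisLanTaylorThorne2016_inducedPairLimit_two`; the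
sibling `HarrisLanTaylorThorneTwistedPairLimitVsBaseChange.lean` REFUTES it modulo Arthur–Clozel's
quadratic base change (`HarrisLanTaylorThorne2016_twistedPairLimit_two.not_of_arthurClozel`:
`ArthurClozel1989_strongLifting_cuspidal → ArthurClozel1989_strongLifting_archimedean → ¬` this fact,
via Ramanujan's `Δ`, the tree's proved dictionary `f ↦ π_f` and base change to `ℚ(√-23)`), so the
hypotheses of its dependents `GaloisRepGL2CMae_of_facts(')` are jointly contradictory.  The
original description follows.

**Harris–Lan–Taylor–Thorne 2016, §6 at `n = 2`, automorphic half: the twisted pair is an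
algebra-valued `p`-adic limit of cuspidal cohomological eigensystems of the quasi-split unitary group
in `4` variables.**  Standing notation of the paper (§1, p. 8): `F⁺` totally real, `F₀` imaginary
quadratic, `F = F₀F⁺`, `c` the non-trivial element of `Gal(F/F⁺)`, `p` a rational prime which SPLITS
in `F₀`, `ı : ℚ̄_p ≅ ℂ`; `G_n` the quasi-split unitary similitude group of the hermitian lattice
`(𝔇_F^{-1})^n ⊕ 𝓞_F^n` (§1.1), `L_{n,(n),lin} ≅ GL_n /F` its Siegel Levi factor.  Printed chain
(arXiv:1411.6717): §6.1 (pp. 89–91) "We will call a topological `ℤ_p[G_n(ℤ̂^S)\G_n(𝔸^S)/G_n(ℤ̂^S)]`-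
algebra `𝕋` of Galois type if there is a continuous pseudo-representation `T : G_F^S → 𝕋` such that
`d_v^{(i)} T(Frob_v^i) = d_v^{(i)} T_v^{(i)}` for all `v|q ∉ S` and all `i ∈ ℤ`", Lemma 6.2 (the
Hecke algebra `𝕋^S_{U^p(N₁,N₂),ρ_t}` on CLASSICAL cusp forms of sufficiently regular weight `ρ_t` and
level `U^p(N₁,N₂)` is of Galois type — proof: `𝕋 ⊗ ℚ̄_p ≅ ⊕_Π ℚ̄_p` over "irreducible admissible
representations of `G_n(𝔸^∞)` with `Π^{U^p(N₁,N₂)} ≠ (0)` which occur in `H⁰(X^{min} × Spec ℚ̄_p,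
ℰ^{sub}_{ρ_t})`" and Cor. 1.3 for each of them), Cor. 6.3–6.4 (by Katz's density lemma the ordinary
`p`-adic Hecke algebras `𝕋^{ord,S}_{U^p(N),ρ}(W)`, `W` finitely generated and Hecke-stable inside the
`p`-adic cusp forms `H⁰(𝔛^{ord,min}_{U^p(N)}, ℰ^{ord,sub}_ρ)`, are of Galois type), Prop. 6.5,
Cor. 6.17–6.25 (the rigid cohomology of the ordinary locus is computed by ordinary overconvergent cusp
forms of finite slope, and `Ind(π^∞‖det‖^N)` is a subquotient of it, Cor. 6.25), whence Cor. 6.26/6.27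
(pp. 100–101): for `π` cuspidal on `GL_n(𝔸_F)` with `π_∞` regular algebraic and all sufficiently
large `N`, "`R_{p,ı}(π,N)|_{W_{F_v}}^{ss} = ı⁻¹rec(π_v|det|^{(1-n)/2}) ⊕ (ı⁻¹rec(π_{ᶜv}|det|^{(1-n)/2}))^{∨,c}
ε_p^{1-2n-2N}`" at every `v ∣ q`, `q ≠ p` "above which `π` and `F` are unramified".

What is stated (the case `n = 2`, i.e. `G_2`, whose unitary group is the quasi-split `U(2,2)` of
`F/F⁺`, rendered as Mok's `U_{F/F⁺}(4)` = `UnitaryGroup.quasiSplitDatum`; tree vocabulary, no Galois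
group, no Shimura variety): the CONTENT OF THAT CHAIN MINUS ITS TWO GALOIS-THEORETIC INPUTS (Cor. 1.3,
stated separately as `HarrisLanTaylorThorne2016_corollary13_cuspidalUnitary`, and Taylor's theorem on
pseudo-representations, proved in the tree as `exists_semisimple_galoisRep_of_algebraValuedLimit`) —
for `K = F` presented as `K/Fp` (`Fp` totally real, `[K:Fp] = 2`, involution `cK ≠ 1`, `K` totally
complex) containing the imaginary quadratic `E₀` with `p` split in `E₀`, `π` regular algebraic
cuspidal on `GL₂(𝔸_K)`, `ι : ℚ̄_p ≃ ℂ`: there are `N₀` and, for each finite place `v`, a `2`-element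
multiset `B_v ∌ 0` of `ℚ̄_p` (the arithmetic-Frobenius eigenvalues of the second summand at `N = 0`,
independent of `N`, exactly as in the accepted `corollary627_splitOrUnramified`) such that for every
`N ≥ N₀` there are a finite `E/ℚ_p` (the field of definition of the eigensystem), a finite set `S` of
finite places of `K` — saturated over the rational primes away from `p` and disjoint from the GOOD
places `v ∣ q`, `q ≠ p` unramified in `K` with `π` unramified above `q` (HLTT's `S` = `p` and the
rational primes above which `F` or `π` ramify) — and polynomials `P_v ∈ ℚ̄_p[X]` with coefficients
in `E` off `S`, equal at the good places to the prescription of Cor. 6.27,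
`arithFrobPolyOfSatake ι q_v 2 α_v · ∏_{b ∈ B_v}(X - b q_v^{-2N})`, such that FOR EVERY `m` there are
finitely many CUSPIDAL automorphic representations `σ'_i` of `U_{K/Fp}(4)(𝔸_{Fp})`
(`UnitaryGroup.CuspidalAutomorphicRepData`; the `Π` of Lemma 6.2, restricted from `G_2` to its
unitary group — cusp forms `ℰ^{sub}`, regular weight `ρ_t`) whose components at the real places are
REGULAR discrete series (`LDSDatum.IsRegular` with `UnitaryGroup.IsNondegenerateLimitOfDiscreteSeriesAt`),
which at every `v ∉ S`, `v ∤ p`, lie over a rational prime unramified in `K` (`e(v|q) = 1`) and are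
unramified with base-change Satake polynomials `Q_i v = arithFrobPolyOfSatake ι q_v 4 β`
(`UnitaryGroup.HasBaseChangeSatakeAt`; HLTT §1.3: `BC(Π)_w`, "does not depend on `ψ`"), and a
`δ > 0`, such that every integer polynomial identity-up-to-`δ` among the coefficients of the `Q_i`
at the places `v ∉ S`, `v ∤ p` holds up to `p^{-m}` for the coefficients of `P` (the extensional
form of "the eigensystem of `Ind(π^∞‖det‖^N)` factors through a quotient `𝕋(W) → ℚ̄_p` of a limit of
the classical Hecke algebras `𝕋^S_{U^p(N₁,N₂),ρ_t}`", Prop. 6.5 and its proof, p. 91).  NO assertion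
is made at the places over `p`: the classical forms of Lemma 6.2 have level `U^p(N₁,N₂)` AT `p`.  The
`σ'_i` are chosen, inside `Π_i|_{U(𝔸)}`, spherical for the hyperspecial subgroups of the tree's
vocabulary (stabilisers of `𝓞_K^4`; at an inert `v` these may differ from HLTT's `G_2^1(𝓞_{F⁺,v})` by
a similitude, which permutes the constituents of `Π_i|_U` without changing unramified base-change
parameters), and the transfer clause is the Frobenius-COEFFICIENT form of "`𝕋` of Galois type" (the
coefficient Hecke operators lie in `𝕋 ⊗ ℤ̄_p` by the integrality of the Satake transform over
`ℤ[q^{±1/2}]`, `q` a unit at `p`).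
Weaker than the printed chain (only `n = 2`; `E`, `S` allowed to depend on `N`; Frobenius-coefficient
form).  Named fact (D-0014): XL (ordinary loci of `U(2,2)` Shimura varieties, their minimal and
toroidal compactifications, rigid cohomology, Katz's density lemma), far beyond the library.
TODO(general form): HLTT prove this for every `n ≥ 1` (`G_n`, `2n`-dimensional prescription) and
with the Hecke ALGEBRA `𝕋(W)` of Galois type (all `T_v^{(i)}`, `i ∈ ℤ`), of which the coefficient-wise
transfer clause below is the consequence used in the proof of Prop. 6.5.
[cite: HarrisLanTaylorThorneRMS2016, §6.1 Lemma 6.2, Cor. 6.3–6.4, Prop. 6.5 (arXiv pp. 89–91); Cor. 6.17–6.27 (arXiv pp. 99–101); §1 p. 8 (standing notation); §1.3 (BC(Π)_w)]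
[file NumberTheory/Automorphic/HarrisLanTaylorThorneTwistedPairLimit] -/
@[deprecated "refuted as stated (verdict clean-up 2026-08-17; prescription at the good places is the \
  Frobenius polynomial of Cor. 6.27's R_{p,i}(pi, N) instead of that of R_p(Ind(pi ||det||^N)) = \
  R_{p,i}(pi, N) (x) eps_p^N, HLTT Res. Math. Sci. 3:37, proof of Cor. 6.27, p. 225): see \
  Literature.NumberTheory.Automorphic.HarrisLanTaylorThorne2016_twistedPairLimit_two.not_of_arthurClozel \
  (HarrisLanTaylorThorneTwistedPairLimitVsBaseChange.lean; the negation modulo the two Arthur-Clozel \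
  base-change leaves) and Literature.NumberTheory.Automorphic.HarrisLanTaylorThorne2016_twistedPairLimit_two.elim \
  / HarrisLanTaylorThorne2016_twistedPairLimit_two_iff_forall_not_isRegularAlgebraic \
  (HarrisLanTaylorThorneTwistedPairLimitMisstated.lean; the fact + any instance of its data -> False); \
  corrected statement: Literature.NumberTheory.Automorphic.HarrisLanTaylorThorne2016_inducedPairLimit_two (same file)"
  (since := "2026-08-17")]
def HarrisLanTaylorThorne2016_twistedPairLimit_two : Prop :=
  ∀ (Fp K : Type) [Field Fp] [NumberField Fp] [Field K] [NumberField K] [Algebra Fp K]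
    (cK : K ≃ₐ[Fp] K), NumberField.IsTotallyReal Fp → Module.finrank Fp K = 2 → ∀ (hc : cK ≠ 1),
    NumberField.IsTotallyComplex K →
    ∀ (hcpt : Literature.NumberTheory.Automorphic.isCompact_glFiniteIntegralLevel 2 K) (p : ℕ) [Fact p.Prime]
      (E₀ : IntermediateField ℚ K), Module.finrank ℚ E₀ = 2 ∧ NumberField.IsTotallyComplex E₀ →
      NumberField.HasTwoPrimesOver E₀ p →
    ∀ (π : Literature.NumberTheory.Automorphic.CuspidalAutomorphicRepData 2 K hcpt), π.1.IsRegularAlgebraic →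
    ∀ (ι : PadicAlgCl p ≃+* ℂ),
    ∃ (N₀ : ℕ) (B : IsDedekindDomain.HeightOneSpectrum (NumberField.RingOfIntegers K) → Multiset (PadicAlgCl p)),
      (∀ v, Multiset.card (B v) = 2 ∧ (0 : PadicAlgCl p) ∉ B v) ∧
      ∀ N, N₀ ≤ N →
        ∃ (E : IntermediateField ℚ_[p] (PadicAlgCl p)) (S : Set (IsDedekindDomain.HeightOneSpectrum (NumberField.RingOfIntegers K)))
          (P : IsDedekindDomain.HeightOneSpectrum (NumberField.RingOfIntegers K) → Polynomial (PadicAlgCl p)),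
          FiniteDimensional ℚ_[p] E ∧ S.Finite ∧
          (∀ v, (∃ q : ℕ, q.Prime ∧ q ≠ p ∧ ((q : ℕ) : NumberField.RingOfIntegers K) ∈ v.asIdeal ∧
              Algebra.IsUnramifiedIn (NumberField.RingOfIntegers K) (Ideal.span {(q : ℤ)}) ∧ π.1.IsUnramifiedAbove q) →
            v ∉ S) ∧
          (∀ v ∈ S, ((p : ℕ) : NumberField.RingOfIntegers K) ∉ v.asIdeal →
            ∀ v' : IsDedekindDomain.HeightOneSpectrum (NumberField.RingOfIntegers K), v'.asIdeal.under ℤ = v.asIdeal.under ℤ → v' ∈ S) ∧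
          (∀ v, (∃ q : ℕ, q.Prime ∧ q ≠ p ∧ ((q : ℕ) : NumberField.RingOfIntegers K) ∈ v.asIdeal ∧
              Algebra.IsUnramifiedIn (NumberField.RingOfIntegers K) (Ideal.span {(q : ℤ)}) ∧ π.1.IsUnramifiedAbove q) →
            ∀ α : Multiset ℂ, π.1.HasSatakeParamAt v α →
              P v = Literature.NumberTheory.Automorphic.arithFrobPolyOfSatake ι v.residueCard 2 α *
                ((B v).map fun b ↦
                  Polynomial.X - Polynomial.C (b * ((v.residueCard : PadicAlgCl p)⁻¹) ^ (2 * N))).prod) ∧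
          (∀ v ∉ S, ∀ k : ℕ, (P v).coeff k ∈ E) ∧
          ∀ m : ℕ, ∃ (r : ℕ) (hcpt4 : Literature.NumberTheory.Automorphic.isCompact_glFiniteIntegralLevel 4 K)
              (σ' : Fin r → Literature.NumberTheory.Automorphic.UnitaryGroup.CuspidalAutomorphicRepData Fp K cK 4 hcpt4)
              (Q : Fin r → IsDedekindDomain.HeightOneSpectrum (NumberField.RingOfIntegers K) → Polynomial (PadicAlgCl p)) (δ : ℝ), 0 < δ ∧
            (∀ i (w : {w : NumberField.InfinitePlace K // w.IsComplex}) (hw : cK • w.1 = w.1),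
                ∃ (a b : ℕ) (d : Literature.NumberTheory.Automorphic.LDSDatum a b), d.IsRegular ∧
                  Literature.NumberTheory.Automorphic.UnitaryGroup.IsNondegenerateLimitOfDiscreteSeriesAt Fp K cK 4
                    (Literature.NumberTheory.Automorphic.StdForm.antidiagonal 4) hcpt4 (σ' i).1 hw hc d) ∧
            (∀ i, ∀ v ∉ S, ((p : ℕ) : NumberField.RingOfIntegers K) ∉ v.asIdeal →
                v.asIdeal.ramificationIdx ℤ = 1 ∧
                (∃ β, Literature.NumberTheory.Automorphic.UnitaryGroup.HasBaseChangeSatakeAt Fp K cK 4 hcpt4 (σ' i).1 v β) ∧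
                ∀ β, Literature.NumberTheory.Automorphic.UnitaryGroup.HasBaseChangeSatakeAt Fp K cK 4 hcpt4 (σ' i).1 v β →
                  Q i v = Literature.NumberTheory.Automorphic.arithFrobPolyOfSatake ι v.residueCard 4 β) ∧
            ∀ F : MvPolynomial (IsDedekindDomain.HeightOneSpectrum (NumberField.RingOfIntegers K) × ℕ) ℤ,
              (∀ vk ∈ F.vars, vk.1 ∉ S ∧ ((p : ℕ) : NumberField.RingOfIntegers K) ∉ vk.1.asIdeal) →
              (∀ i, ‖MvPolynomial.aeval
                  (fun vk : IsDedekindDomain.HeightOneSpectrum (NumberField.RingOfIntegers K) × ℕ => (Q i vk.1).coeff vk.2) F‖ ≤ δ) →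
                ‖MvPolynomial.aeval
                    (fun vk : IsDedekindDomain.HeightOneSpectrum (NumberField.RingOfIntegers K) × ℕ => (P vk.1).coeff vk.2) F‖ ≤
                  (p : ℝ) ^ (-(m : ℤ))

/-- **Harris–Lan–Taylor–Thorne 2016, Cor. 1.3 — cuspidal representations of the quasi-split unitary
group in `2n` variables with regular discrete series at infinity, second alternative on `q`.**
Printed (Res. Math. Sci. 3:37, p. 31 = arXiv:1411.6717 p. 14), in the standing notation `F = F₀F⁺`
(`F⁺` totally real, `F₀` imaginary quadratic), `p` split in `F₀` (§1, p. 8): "**Proposition 1.2.**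
Suppose that `Π` is a square integrable automorphic representation of `G_n(𝔸)` and that `Π_∞` is
cohomological. … **Corollary 1.3.** Keep the assumptions of the proposition. Then there is a
continuous, semi-simple, algebraic (i.e. unramified almost everywhere and de Rham above `p`)
representation `r_{p,ı}(Π) : G_F → GL_{2n}(ℚ̄_p)` with the following property: If `v` is a prime of
`F` above a rational prime `q` such that • either `q` splits in `F₀`, • or `F` and `Π` are unramified
above `q`, then `ı WD(r_{p,ı}(Π)|_{G_{F_v}})^{ss} ≅ rec_{F_v}(BC(Π_q)_v |det|_v^{(1-2n)/2})`.
[Proof:] Combine the proposition with for instance theorem 1.2 of [BLGHT] and theorem A of [BLGGT].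
(These results are due to many people …)"; §1.3 (pp. 13–14): `G_n(ℚ_q) ≅ ∏_i GL_{2n}(F_{w_i}) × H`,
"`BC(Π)_{w_i} = Π_{w_i}` and `BC(Π)_{c w_i} = Π_{w_i}^{∨,c}`", "`Π` is unramified at `v_i` if `v_i`
is unramified in `F` and `Π^{G_n^1(𝓞_{F⁺,v_i})} ≠ (0)`", at such an inert `v_i` the parameter of
`BC(Π)_{v_i}` is read on `Π|_{G_n^1(F⁺_{v_i})}` through `χ ∘ N`, and (Lemma 1.1) "in both cases
`BC(Π_v)` does not depend on `ψ`" (the similitude character).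

Rendering (tree vocabulary; format, vocabulary and the passage `U → GU` are those of the accepted
sibling facts `GoldringKoskivirta2019_galoisRep_unitary` /
`HarrisLanTaylorThorne2016_galoisRep_unitary_discreteSeries` of this file, see their docstrings and
scope review): `K = F` CM presented as `K/Fp` (`Fp = F⁺` totally real, `[K:Fp] = 2`, involution
`cK ≠ 1`, `K` totally complex) with an imaginary quadratic `E₀ = F₀ ⊆ K` in which `p` splits
(`HasTwoPrimesOver E₀ p`); the unitary group `G_n^1 = ker ν` of HLTT's `G_n` is the quasi-split unitary
group of `K/Fp` in `2n` variables, i.e. Mok's `U_{K/Fp}(2n)` (`UnitaryGroup.quasiSplitDatum`; quasi-split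
unitary groups of a given rank for `K/Fp` are isomorphic); `σ'` is a CUSPIDAL automorphic
representation of `U_{K/Fp}(2n)(𝔸_{Fp})` (`UnitaryGroup.CuspidalAutomorphicRepData`) whose component at
every real place is a discrete series with REGULAR Harish-Chandra parameter (`LDSDatum.IsRegular` with
`UnitaryGroup.IsNondegenerateLimitOfDiscreteSeriesAt`), so that `σ'` extends to a cuspidal — in
particular square integrable — `Π` on `G_n(𝔸)` with `Π_∞` discrete series of regular infinitesimal
character, hence cohomological (Fakhruddin–Pilloni 2021, proof of Thm. 9.11: `res : 𝔄_cusp(GU)_{c'} →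
𝔄_cusp(U)_c` is surjective for every algebraic `c'` extending the central character; "the Satake
parameters of `π̃'_v` and `π̃_v` are related via the map on dual groups `ĜU(n) → Û(n)` (which forgets the
`𝔾_m`). There is a similar story at archimedean places"), and `BC(Π_q)_w` has Satake parameter the
base-change Satake parameter of `σ'` at `w` (`UnitaryGroup.HasBaseChangeSatakeAt`: Mok's `ξ_1`, no
constraint at `w ≠ c w`, `β_{N-1-i} = β_i⁻¹` at `w = c w` = HLTT's `χ ∘ N`).  Conclusion (uniqueness,
"algebraic", the first alternative "`q` splits in `F₀`" and the places over `p` dropped; the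
Weil–Deligne isomorphism at the unramified `w` rendered, exactly as in the accepted
`exists_galoisRep_of_regularAlgebraic` and `corollary627_splitOrUnramified`, by the characteristic
polynomial `arithFrobPolyOfSatake ι q_u (2n) β` of the ARITHMETIC Frobenius): a continuous semisimple
`r : Γ_K → GL_{2n}(ℚ̄_p)` such that at every finite place `u ∤ p` of `K` lying over a rational prime
above which `K` is unramified and `σ'` is unramified at every place (`e(u'|q) = 1` and
`UnitaryGroup.IsUnramifiedAt` for all `u'` over the same rational prime: "`F` and `Π` are unramified
above `q`"), and every base-change Satake parameter `β` of `σ'` at `u`, `r` is unramified at `u` with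
that characteristic polynomial.  Unlike the two sibling facts (Goldring–Koskivirta's format,
`p ∉ Ram(G) ∪ Ram(σ')`) NO hypothesis is imposed at the places over `p`, as in the printed corollary
(whose `Π` may have any level at `p`; this is how HLTT use it in Lemma 6.2, for forms of level
`U^p(N₁,N₂)`).  Not proved here (named fact, D-0014; Shin 2011 / Goldring–Shin App. A, Chenevier–Harris
2013 Thm. 3.2.3, Caraiani 2012 — XL).  Caveat recorded (truth unaffected): at a place `v` of `Fp`
inert and unramified in `K` and even rank `2n`, the hyperspecial subgroup of the tree's vocabulary
(the stabiliser of `𝓞_K^{2n}` for Mok's anti-diagonal form, `UnitaryGroup.level`) and HLTT's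
`G_n^1(𝓞_{F⁺,v})` (the stabiliser of `Λ_n`) may lie in different `U(F⁺_v)`-conjugacy classes of
hyperspecial subgroups; unramifiedness and the base-change Satake parameter `χ ∘ N` do not depend on
the class, and compatibility at every `v ∤ p` holds for either (Chenevier–Harris 2013 Thm. 3.2.3 with
Caraiani 2012).  The degenerate rank `n = 0` is the proved
`GoldringKoskivirta2019_galoisRep_unitary_rank_zero` (`2 * 0 = 0`).  TODO(general form): HLTT prove Cor. 1.3 for SQUARE-INTEGRABLE
`Π` on `G_n` with `Π_∞` cohomological of any type, with the first alternative "`q` splits in `F₀`" as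
well, with `r` de Rham above `p`; only cuspidal `σ'` on `U_{K/Fp}(2n)` with regular discrete series at
infinity and the second alternative at `u ∤ p` are typed.
[cite: HarrisLanTaylorThorneRMS2016, Prop. 1.2 and Cor. 1.3 (p. 31; arXiv p. 14), §1 p. 8 (standing notation), §1.3 and Lemma 1.1 (BC(Π)_w)]
[cite: FakhruddinPilloni2021, §9.2, proof of Thm. 9.11 (extension from U(n) to GU(n))]
[file NumberTheory/Automorphic/UnitaryCoherentGaloisRep] -/
def HarrisLanTaylorThorne2016_corollary13_cuspidalUnitary : Prop :=
  ∀ (Fp K : Type) [Field Fp] [NumberField Fp] [Field K] [NumberField K] [Algebra Fp K]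
    (cK : K ≃ₐ[Fp] K), NumberField.IsTotallyReal Fp → Module.finrank Fp K = 2 → ∀ (hc : cK ≠ 1),
    NumberField.IsTotallyComplex K → ∀ (n : ℕ) (p : ℕ) [Fact p.Prime] (ι : PadicAlgCl p ≃+* ℂ)
    (E₀ : IntermediateField ℚ K), Module.finrank ℚ E₀ = 2 ∧ NumberField.IsTotallyComplex E₀ →
      NumberField.HasTwoPrimesOver E₀ p →
    ∀ (hcptK : Literature.NumberTheory.Automorphic.isCompact_glFiniteIntegralLevel (2 * n) K)
    (σ' : Literature.NumberTheory.Automorphic.UnitaryGroup.CuspidalAutomorphicRepData Fp K cK (2 * n) hcptK),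
    (∀ (w : {w : NumberField.InfinitePlace K // w.IsComplex}) (hw : cK • w.1 = w.1),
      ∃ (a b : ℕ) (d : Literature.NumberTheory.Automorphic.LDSDatum a b), d.IsRegular ∧
        Literature.NumberTheory.Automorphic.UnitaryGroup.IsNondegenerateLimitOfDiscreteSeriesAt Fp K cK (2 * n)
          (Literature.NumberTheory.Automorphic.StdForm.antidiagonal (2 * n)) hcptK σ'.1 hw hc d) →
    ∃ r : Literature.NumberTheory.GaloisRepresentations.FramedGaloisRep K (PadicAlgCl p) (2 * n), r.toGaloisRep.IsSemisimple ∧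
      ∀ (u : IsDedekindDomain.HeightOneSpectrum (NumberField.RingOfIntegers K)) (β : Multiset ℂ), ((p : ℕ) : NumberField.RingOfIntegers K) ∉ u.asIdeal →
        (∀ u' : IsDedekindDomain.HeightOneSpectrum (NumberField.RingOfIntegers K), u'.asIdeal.under ℤ = u.asIdeal.under ℤ →
          u'.asIdeal.ramificationIdx ℤ = 1 ∧
            Literature.NumberTheory.Automorphic.UnitaryGroup.IsUnramifiedAt Fp K cK (2 * n) hcptK σ'.1 u') →
        Literature.NumberTheory.Automorphic.UnitaryGroup.HasBaseChangeSatakeAt Fp K cK (2 * n) hcptK σ'.1 u β →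
          r.IsUnramifiedAt u ∧
            r.HasFrobCharpolyAt u (Literature.NumberTheory.Automorphic.arithFrobPolyOfSatake ι u.residueCard (2 * n) β)

/-- **Harris–Lan–Taylor–Thorne 2016, §6 at `n = 2`, automorphic half — CORRECTED (induced) form:
the eigensystem of `Ind(π^∞‖det‖^N)` is an algebra-valued `p`-adic limit of cuspidal cohomological
eigensystems of the quasi-split unitary group in `4` variables.**  This is the restatement of the
mis-stated — refuted as stated and `@[deprecated]` since the verdict clean-up of 2026-08-17 —
`HarrisLanTaylorThorne2016_twistedPairLimit_two` above (review-split, 2026-08-17, with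
the source re-read); it differs from it in EXACTLY ONE clause, the prescription at the good places,
and every other clause — together with its rendering notes, scope remarks and TODO(general form) in
the docstring above — is kept verbatim.

Source (Res. Math. Sci. 3:37; standing notation §1, p. 11: `F = F₀F⁺`, `F⁺` totally real, `F₀`
imaginary quadratic, `p` SPLITS in `F₀`, `ı : ℚ̄_p ≅ ℂ`).  §6.1, p. 197: "We will call a topological
`ℤ_p[G_n(ℤ̂^S)\G_n(𝔸^S)/G_n(ℤ̂^S)]`-algebra `𝕋` of Galois type if there is a continuous
pseudo-representation `T : G_F^S → 𝕋` such that `d_v^{(i)} T(Frob_v^i) = d_v^{(i)} T_v^{(i)}` for all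
`v|q ∉ S` and all `i ∈ ℤ`"; Lemma 6.2 (pp. 197–198): for `t` sufficiently large the Hecke algebra
`𝕋^S_{U^p(N₁,N₂),ρ_t}` on the CLASSICAL cusp forms `H⁰(X^{min}_{U^p(N₁,N₂)}, ℰ^{sub}_{ρ_t})` is of Galois
type (proof: by Lemma 5.11, p. 192, `𝕋 ⊗ ℚ̄_p ≅ ⊕_Π ℚ̄_p` over the `Π` occurring in
`H⁰(X^{min} × Spec ℚ̄_p, ℰ^{sub}_{ρ_t})` with `Π^{U^p(N₁,N₂)} ≠ (0)`, each the finite part of a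
cohomological CUSPIDAL automorphic representation of `G_n(𝔸)`, and Cor. 5.12, p. 193 — Cor. 1.3 for
each of them); Cor. 6.3–6.4 (p. 199, from Katz's density Lemma 6.1, p. 194, and Lemma 6.2): the ordinary
`p`-adic Hecke algebras `𝕋^{ord,S}_{U^p(N),ρ}(W)` are of
Galois type; Prop. 6.5 (p. 199) and its proof (pp. 199–200): the eigensystem
`θ : 𝕋^{ord,S}_{U^p(N),ρ}((Π')^{U^p(N)}) → ℚ̄_p` of an irreducible quotient `Π` of an admissible
submodule `Π'` of `H⁰(𝔛^{ord,min}, ℰ^{ord,sub}_ρ)_{ℚ̄_p}` "sends `T_v^{(i)}` to its eigenvalue on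
`Π^{G_n(ℤ_q)}`", `S` = `p` and the primes where `F` or `Π` ramify; Cor. 6.13, 6.18, 6.23
(pp. 218–223) carry Prop. 6.5 over to the subquotients of the ordinary overconvergent cusp forms of
finite slope, of the cohomology of differentials, and of the rigid cohomology `H^i_{c-∂}` of the
ordinary locus, and Cor. 6.25 (p. 224):
`Ind_{P^{(m),+}_{n,(n)}(𝔸^{p,∞})}^{G_n^{(m)}(𝔸^{p,∞})} H^i_{Int}(𝔗^{(m)}_{(n)}, ℚ̄_p)^{ℤ_p^×}` is a
subquotient of `W₀H^{i+1}_{c-∂}`; Cor. 6.26 (p. 225): for `π` an irreducible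
`L_{n,(n),lin}(𝔸^∞)`-subquotient of
`H^i_{Int}(𝔗^{(m)}_{(n)}, ℚ̄_p)`, "`R_p(π)|_{W_{F_v}}^{ss} ≅ rec_{F_v}(π_v|det|_v^{(1-n)/2}) ⊕
rec_{F_{ᶜv}}(π_{ᶜv}|det|_{ᶜv}^{(1-n)/2})^{∨,c} ε_p^{1-2n}`" at the primes `v | q`, `q ≠ p` unramified
in `F` with `π` unramified above `q`; Cor. 6.27 (p. 225), for `π` cuspidal on `GL_n(𝔸_F)` with `π_∞`
of algebraic infinitesimal character and all sufficiently large `N`: `R_{p,ı}(π, N)` with second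
summand twisted by `ε_p^{1-2n-2N}`, "**Proof** Take `R_{p,ı}(π, N) = R_p(ı⁻¹(π^∞‖det‖^N)) ⊗ ε_p^{-N}`."

Hence the object which §6 exhibits as a limit of classical cusp forms is the eigensystem of
`Π_N = Ind(ı⁻¹(π^∞‖det‖^N))`, whose Galois avatar is Cor. 6.26 applied to `π‖det‖^N`, i.e.
`R_p(Π_N) = R_{p,ı}(π, N) ⊗ ε_p^{N} = r ε_p^{N} ⊕ r^{c,∨} ε_p^{1-2n-N}` — NOT Cor. 6.27's
`R_{p,ı}(π, N)`, which is recovered afterwards by the Tate twist `⊗ ε_p^{-N}` (a twist that is not a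
limit of `U(n,n)`-eigensystems: those are `ε_p^{1-2n}`-polarised).  At a good place `v` (`q = q_v`,
`ε_p(Frob_v^{arith}) = q`, Satake parameter of `(π‖det‖^N)_v` = `α_v q^{-N}`) the arithmetic-Frobenius
polynomial of `R_p(Π_N)` is therefore
`arithFrobPolyOfSatake ι q 2 (α_v · q^{-N}) · ∏_{b ∈ B_v} (X - b q^{-N})`, `B_v` the (non-zero,
`N`-independent) arithmetic-Frobenius eigenvalues at `v` of `r^{c,∨} ε_p^{-3}` — THIS is the
prescription below; the sibling `HarrisLanTaylorThorneTwistedPairLimitMisstated.lean` proves that it is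
the old prescription with every root multiplied by `q^{N}` (`inducedPairPrescription_eq_scaleRoots`)
and that its constant coefficient is independent of `N` (`eval_zero_inducedPair_prescription`), so the
inert-place obstruction which refutes the old fact (`β₃ = β₀⁻¹`, `β₂ = β₁⁻¹`, constant coefficient
`q_w^{-6}` for every approximant) is passed.  Why the transfer clause follows from the printed proof
(recorded for the discharger; nothing beyond §6.1 is used): `θ_N` is realised on a finite free
Hecke-stable `𝓞_L`-lattice `W` (`L/ℚ_p` finite) inside the `p`-adic cusp forms; by Katz's Lemma 6.1
`W/p^M` is, Hecke-equivariantly, a subquotient of the classical cusp forms of weight `ρ_t`, `t ≫_M 0`,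
so the Hecke action on it factors through `𝕋_t = 𝕋^S_{U^p(N₁,N₂),ρ_t}`; `𝕋_t ⊗ ℚ̄_p ≅ ⊕_i ℚ̄_p`
(Lemma 5.11) embeds `𝕋_t ⊗ ℤ̄_p` with finite index `p^{c_t}` into `∏_i ℤ̄_p`, the `i`-th coordinate
being the eigensystem of a classical cuspidal `Π_i`; the coefficients of the Frobenius polynomial are
`ℤ[q^{±1/2}]`-integral Hecke operators (Satake), so an integer polynomial `F` in them with
`|F(Q_i)| ≤ p^{-m-c_t}` for all `i` acts on `W/p^M` within `p^{m} 𝕋_t`, whence `|F(P)| = |θ_N(F)| ≤ p^{-m}`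
(`M ≥ m`).  As in the docstring above: only `n = 2` (`G_2`, unitary group `U(2,2) = U_{K/Fp}(4)`,
`UnitaryGroup.quasiSplitDatum`), `E`, `S` may depend on `N`, Frobenius-COEFFICIENT form of "Galois
type", the `σ'_i` = the `Π_i` restricted to the unitary group (cuspidal, REGULAR discrete series at
the real places for `t ≫ 0`, spherical for the tree's hyperspecial subgroups at `v ∉ S`, `v ∤ p`, with
base-change Satake polynomials `Q_i v`, §1.3), NO assertion at the places over `p`, and the two
Galois-theoretic inputs (Cor. 1.3 = `HarrisLanTaylorThorne2016_corollary13_cuspidalUnitary`, Taylor's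
pseudo-representation theorem) excised.  Named fact (D-0014), XL (ordinary loci of `U(2,2)` Shimura
varieties, compactifications, rigid cohomology, Katz density); it is literally the route stub S1'
`stub_inducedPairLimit` (`Summits/Langlands/Langlands/Cruxes/GaloisRepGL2CMae/Lines/Sketch.lean`).
TODO(general form): every `n ≥ 1`, the Hecke ALGEBRA `𝕋(W)` of Galois type, `E`, `S` uniform in `N`.
[cite: HarrisLanTaylorThorneRMS2016, §6.1 pp. 197–200 (Galois type, Lemma 6.2, Cor. 6.3–6.4, Prop. 6.5 and proof); Cor. 6.13, 6.18, 6.23, 6.25 (pp. 218–224); Cor. 6.26–6.27 and proof of Cor. 6.27 (p. 225); Lemma 5.11, Cor. 5.12 (pp. 192–193); §1 p. 11 (standing notation); §1.3 (BC(Π)_w)]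
[file NumberTheory/Automorphic/HarrisLanTaylorThorneTwistedPairLimit] -/
def HarrisLanTaylorThorne2016_inducedPairLimit_two : Prop :=
  ∀ (Fp K : Type) [Field Fp] [NumberField Fp] [Field K] [NumberField K] [Algebra Fp K]
    (cK : K ≃ₐ[Fp] K), NumberField.IsTotallyReal Fp → Module.finrank Fp K = 2 → ∀ (hc : cK ≠ 1),
    NumberField.IsTotallyComplex K →
    ∀ (hcpt : isCompact_glFiniteIntegralLevel 2 K) (p : ℕ) [Fact p.Prime]
      (E₀ : IntermediateField ℚ K), Module.finrank ℚ E₀ = 2 ∧ NumberField.IsTotallyComplex E₀ →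
      NumberField.HasTwoPrimesOver E₀ p →
    ∀ (π : CuspidalAutomorphicRepData 2 K hcpt), π.1.IsRegularAlgebraic →
    ∀ (ι : PadicAlgCl p ≃+* ℂ),
    ∃ (N₀ : ℕ) (B : HeightOneSpectrum (NumberField.RingOfIntegers K) → Multiset (PadicAlgCl p)),
      (∀ v, Multiset.card (B v) = 2 ∧ (0 : PadicAlgCl p) ∉ B v) ∧
      ∀ N, N₀ ≤ N →
        ∃ (E : IntermediateField ℚ_[p] (PadicAlgCl p)) (S : Set (HeightOneSpectrum (NumberField.RingOfIntegers K)))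
          (P : HeightOneSpectrum (NumberField.RingOfIntegers K) → (PadicAlgCl p)[X]),
          FiniteDimensional ℚ_[p] E ∧ S.Finite ∧
          (∀ v, (∃ q : ℕ, q.Prime ∧ q ≠ p ∧ ((q : ℕ) : NumberField.RingOfIntegers K) ∈ v.asIdeal ∧
              Algebra.IsUnramifiedIn (NumberField.RingOfIntegers K) (Ideal.span {(q : ℤ)}) ∧ π.1.IsUnramifiedAbove q) →
            v ∉ S) ∧
          (∀ v ∈ S, ((p : ℕ) : NumberField.RingOfIntegers K) ∉ v.asIdeal →
            ∀ v' : HeightOneSpectrum (NumberField.RingOfIntegers K), v'.asIdeal.under ℤ = v.asIdeal.under ℤ → v' ∈ S) ∧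
          (∀ v, (∃ q : ℕ, q.Prime ∧ q ≠ p ∧ ((q : ℕ) : NumberField.RingOfIntegers K) ∈ v.asIdeal ∧
              Algebra.IsUnramifiedIn (NumberField.RingOfIntegers K) (Ideal.span {(q : ℤ)}) ∧ π.1.IsUnramifiedAbove q) →
            ∀ α : Multiset ℂ, π.1.HasSatakeParamAt v α →
              P v = arithFrobPolyOfSatake ι v.residueCard 2
                  (α.map (· * ((v.residueCard : ℂ)⁻¹) ^ N)) *
                ((B v).map fun b ↦
                  X - C (b * ((v.residueCard : PadicAlgCl p)⁻¹) ^ N)).prod) ∧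
          (∀ v ∉ S, ∀ k : ℕ, (P v).coeff k ∈ E) ∧
          ∀ m : ℕ, ∃ (r : ℕ) (hcpt4 : isCompact_glFiniteIntegralLevel 4 K)
              (σ' : Fin r → UnitaryGroup.CuspidalAutomorphicRepData Fp K cK 4 hcpt4)
              (Q : Fin r → HeightOneSpectrum (NumberField.RingOfIntegers K) → (PadicAlgCl p)[X]) (δ : ℝ), 0 < δ ∧
            (∀ i (w : {w : NumberField.InfinitePlace K // w.IsComplex}) (hw : cK • w.1 = w.1),
                ∃ (a b : ℕ) (d : LDSDatum a b), d.IsRegular ∧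
                  UnitaryGroup.IsNondegenerateLimitOfDiscreteSeriesAt Fp K cK 4
                    (StdForm.antidiagonal 4) hcpt4 (σ' i).1 hw hc d) ∧
            (∀ i, ∀ v ∉ S, ((p : ℕ) : NumberField.RingOfIntegers K) ∉ v.asIdeal →
                v.asIdeal.ramificationIdx ℤ = 1 ∧
                (∃ β, UnitaryGroup.HasBaseChangeSatakeAt Fp K cK 4 hcpt4 (σ' i).1 v β) ∧
                ∀ β, UnitaryGroup.HasBaseChangeSatakeAt Fp K cK 4 hcpt4 (σ' i).1 v β →
                  Q i v = arithFrobPolyOfSatake ι v.residueCard 4 β) ∧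
            ∀ F : MvPolynomial (HeightOneSpectrum (NumberField.RingOfIntegers K) × ℕ) ℤ,
              (∀ vk ∈ F.vars, vk.1 ∉ S ∧ ((p : ℕ) : NumberField.RingOfIntegers K) ∉ vk.1.asIdeal) →
              (∀ i, ‖MvPolynomial.aeval
                  (fun vk : HeightOneSpectrum (NumberField.RingOfIntegers K) × ℕ => (Q i vk.1).coeff vk.2) F‖ ≤ δ) →
                ‖MvPolynomial.aeval
                    (fun vk : HeightOneSpectrum (NumberField.RingOfIntegers K) × ℕ => (P vk.1).coeff vk.2) F‖ ≤
                  (p : ℝ) ^ (-(m : ℤ))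

end Literature.NumberTheory.Automorphic
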